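import Mathlib
import Summits.MatrixMultiplication.MatrixMultiplication.Theses.FidelityWitnesses
import Summits.MatrixMultiplication.MatrixMultiplication.Theorems.FidelityWitnessesDiagonalPowerDecayGlue
import Summits.MatrixMultiplication.MatrixMultiplication.Theorems.FidelityWitnessesDiagonalPowerDecayBlockSelfSimilarity

/-!
# `FidelityWitnesses.DiagonalPowerDecay` (stmt-MatrixMultiplication-14053) — the STRATEGIST'S SPLIT
# `QualitativeDiagonalDecay → BoundedSynergy → DiagonalPowerDecay`

`T_n = ⟨n,n,n⟩ = matMulTensor ℂ n n n` (`‖T_n‖² = n³`), `M(n) := M(n,n²) = sup {|⟨S,T_n⟩|²/‖S‖² : R(S) ≤ n²}`,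
`φ(n) = M(n)/n³`.  The crux is `∃ C δ>0 ∀ n, M(n) ≤ C n^{3−2δ}`.  By Kronecker products `M` is
SUPER-multiplicative (`M(nm) ≥ M(n)M(m)`, crux workfile `Disproof.lean` § (e)), so `γ := lim log_n M(n)` exists and
`M(n) ≤ n^γ` for every `n`; the crux is `γ < 3`.  Two named statements, each STRICTLY WEAKER than the crux in the
sense that neither is known to imply `2 < ω(ℂ)`:

* QUALITATIVE DIAGONAL DECAY `QD` — `φ(n) → 0` with no rate:
  `∀ ε > 0 ∃ N ∀ n ≥ N ∀ S, R(S) ≤ n² → |⟨S,T_n⟩|² ≤ ε·n³·‖S‖²`.  Implied by the crux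
  (`qualitativeDecay_of_diagonalPowerDecay`), consistent with `ω(ℂ) = 2`, and already a superlinear (border-)rank
  lower bound for `⟨m,m,m⟩` (`superlinear_tensorRank_of_qualitativeDecay`, lead c4, p120930 / p121281).
* BOUNDED SYNERGY `BS` — capture bounds TENSORISE up to a constant: `∃ C ∀ n m, M(n·m) ≤ C·M(n)·M(m)`, in witness
  form "`∀ Bₙ Bₘ`, (every rank-`≤ n²` tensor captures `≤ Bₙ`) → (every rank-`≤ m²` tensor captures `≤ Bₘ`) → every
  rank-`≤ (nm)²` tensor of the `nm × nm` format captures `≤ C·Bₙ·Bₘ`".  Informally (Fekete's lemma along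
  Kronecker powers) it says `φ(n) ≥ c·n^{γ−3}` for all `n`: the capture exponent is ATTAINED up to a constant at every
  scale (no `n^{o(1)}` synergy between scales).  It does not imply the crux (a constant profile `φ ≡ φ_∞ > 0`
  satisfies it) and is not implied by it (the crux allows an irregular profile below `C n^{−2δ}`).

THEOREM (`DiagonalPowerDecay_of_subs`): `QD → BS → DiagonalPowerDecay`, with the explicit witness
`δ = 1/(2n₁)`, `C = n₁³`, where `n₁ = max N 2` and `N` is the `QD`-threshold for `ε = 1/(2·max C_BS 1)`.
Proof.  (i) `QD` at `n₁`: `M(n₁) ≤ n₁³/(2C)`.  (ii) Iterating `BS` along `n₁^{k+1} = n₁^k · n₁`: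
`M(n₁^{k+1}) ≤ C · (n₁³/2)^k/… · n₁³/(2C)`, i.e. `M(n₁^k) ≤ (n₁³/2)^k` for all `k ≥ 1` (`split_iter`).
(iii) PADDING MONOTONICITY (`split_capture_pad`: a rank-`≤ n²` tensor of the `n × n` format is, zero-padded, a
rank-`≤ N²` tensor of the `N × N` format with the same overlap and norm, `n ≤ N`; restriction normal form as in the
landed `dpdGlue_body_at_emb`) transfers the bound at `n₁^{j+1}` to every `n` with `n₁^j ≤ n < n₁^{j+1}`
(`j = Nat.log n₁ n`), and (iv) the bookkeeping `(n₁³/2)^{j+1} ≤ n₁³ · n^{3 − 1/n₁}` uses only `n₁^{1/n₁} ≤ 2`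
(`n₁ ≤ 2^{n₁}`).  So ANY decay at one scale is upgraded to POWER decay by bounded synergy; conversely the crux needs no
more than these two.  What the split isolates: `QD` is the rank-lower-bound content (open, frontier `3m² − o(m²)` /
`2m² − log m`), `BS` is the cross-scale REGULARITY content (the rate upgrade); neither alone is `≥ 2 < ω(ℂ)`.
Supports item `stmt-MatrixMultiplication-14053`; Mathlib + landed tree lemmas only; no definitions.
-/

set_option linter.dupNamespace false

namespace Summit.MatrixMultiplication.MatrixMultiplication.Theorems.DiagonalPowerDecay

open scoped BigOperators
open Literature.Computability.AlgebraicComplexity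
open Summit.MatrixMultiplication.MatrixMultiplication.Theses.FidelityWitnesses (DiagonalPowerDecay)

/-! ## Padding monotonicity `M(n) ≤ M(N)` for `n ≤ N`, in witness form -/

/-- **Padding monotonicity.**  A capture bound `B` valid for every rank-`≤ N²` tensor of the `N × N` format is valid
for every rank-`≤ n²` tensor of the `n × n` format, `n ≤ N`: zero-pad `S` along `e = castLE × castLE` in restriction
normal form `S' x y z = Σ_{abc} [e a = x][e b = y][e c = z]·S_{abc}` (`R(S') ≤ R(S) ≤ n² ≤ N²`, same overlap with
`⟨N,N,N⟩ ∘ e³ = ⟨n,n,n⟩`, same norm). [folklore] -/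
theorem split_capture_pad {n N : ℕ} (h : n ≤ N) {B : ℝ}
    (hB : ∀ S : (Fin N × Fin N) → (Fin N × Fin N) → (Fin N × Fin N) → ℂ, tensorRank S ≤ N ^ 2 →
      ‖∑ a, ∑ b, ∑ c, S a b c * matMulTensor ℂ N N N a b c‖ ^ 2 ≤ B * ∑ a, ∑ b, ∑ c, ‖S a b c‖ ^ 2)
    (S : (Fin n × Fin n) → (Fin n × Fin n) → (Fin n × Fin n) → ℂ) (hS : tensorRank S ≤ n ^ 2) :
    ‖∑ a, ∑ b, ∑ c, S a b c * matMulTensor ℂ n n n a b c‖ ^ 2 ≤ B * ∑ a, ∑ b, ∑ c, ‖S a b c‖ ^ 2 := by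
  classical
  -- the coordinate embedding
  set e : Fin n × Fin n → Fin N × Fin N := Prod.map (Fin.castLE h) (Fin.castLE h) with he
  have hinj : Function.Injective e := (Fin.castLE_injective h).prodMap (Fin.castLE_injective h)
  have hT : ∀ a b c, matMulTensor ℂ N N N (e a) (e b) (e c) = matMulTensor ℂ n n n a b c := by
    intro a b c
    rw [Literature.CplxAlg.matMulTensor_eq_comp_castLE ℂ h]
  -- the padded tensor, in restriction normal form
  obtain ⟨S', hS'⟩ : ∃ S' : (Fin N × Fin N) → (Fin N × Fin N) → (Fin N × Fin N) → ℂ, ∀ x y z,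
      S' x y z = ∑ a, ∑ b, ∑ c, (if e a = x then (1 : ℂ) else 0) * (if e b = y then (1 : ℂ) else 0) *
        (if e c = z then (1 : ℂ) else 0) * S a b c :=
    ⟨fun x y z => ∑ a, ∑ b, ∑ c, (if e a = x then (1 : ℂ) else 0) *
      (if e b = y then (1 : ℂ) else 0) * (if e c = z then (1 : ℂ) else 0) * S a b c, fun _ _ _ => rfl⟩
  -- rank: `S'` is a restriction of `S`
  have hRank : tensorRank S' ≤ tensorRank S :=
    TensorRestrictsTo.tensorRank_le ⟨fun x a => if e a = x then (1 : ℂ) else 0,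
      fun y b => if e b = y then (1 : ℂ) else 0, fun z c => if e c = z then (1 : ℂ) else 0, hS'⟩
  -- values on the box
  have hOn : ∀ a b c, S' (e a) (e b) (e c) = S a b c := by
    intro a₀ b₀ c₀
    rw [hS']
    simp only [hinj.eq_iff]
    rw [Finset.sum_eq_single a₀, Finset.sum_eq_single b₀, Finset.sum_eq_single c₀]
    · simp
    all_goals first
      | (intro i _ hi; simp [hi])
      | simp
  -- values off the box
  have hOffx : ∀ x, (∀ a, e a ≠ x) → ∀ y z, S' x y z = 0 := fun x hx y z => by
    rw [hS']
    exact Finset.sum_eq_zero fun a _ => Finset.sum_eq_zero fun b _ =>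
      Finset.sum_eq_zero fun c _ => by simp [hx a]
  have hOffy : ∀ y, (∀ b, e b ≠ y) → ∀ x z, S' x y z = 0 := fun y hy x z => by
    rw [hS']
    exact Finset.sum_eq_zero fun a _ => Finset.sum_eq_zero fun b _ =>
      Finset.sum_eq_zero fun c _ => by simp [hy b]
  have hOffz : ∀ z, (∀ c, e c ≠ z) → ∀ x y, S' x y z = 0 := fun z hz x y => by
    rw [hS']
    exact Finset.sum_eq_zero fun a _ => Finset.sum_eq_zero fun b _ =>
      Finset.sum_eq_zero fun c _ => by simp [hz c]
  -- overlap with `⟨N,N,N⟩` = overlap with `⟨n,n,n⟩`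
  have hOver : (∑ x, ∑ y, ∑ z, S' x y z * matMulTensor ℂ N N N x y z) =
      ∑ a, ∑ b, ∑ c, S a b c * matMulTensor ℂ n n n a b c :=
    calc (∑ x, ∑ y, ∑ z, S' x y z * matMulTensor ℂ N N N x y z)
        = ∑ a, ∑ y, ∑ z, S' (e a) y z * matMulTensor ℂ N N N (e a) y z :=
          dpdGlue_sum_eq_sum_emb hinj _ fun x hx => by
            simp only [hOffx x hx, zero_mul, Finset.sum_const_zero]
      _ = ∑ a, ∑ b, ∑ z, S' (e a) (e b) z * matMulTensor ℂ N N N (e a) (e b) z :=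
          Finset.sum_congr rfl fun a _ => dpdGlue_sum_eq_sum_emb hinj _ fun y hy => by
            simp only [hOffy y hy, zero_mul, Finset.sum_const_zero]
      _ = ∑ a, ∑ b, ∑ c, S' (e a) (e b) (e c) * matMulTensor ℂ N N N (e a) (e b) (e c) :=
          Finset.sum_congr rfl fun a _ => Finset.sum_congr rfl fun b _ =>
            dpdGlue_sum_eq_sum_emb hinj _ fun z hz => by
              simp only [hOffz z hz, zero_mul]
      _ = ∑ a, ∑ b, ∑ c, S a b c * matMulTensor ℂ n n n a b c := by
          simp only [hOn, hT]
  -- squared norm is preserved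
  have hNorm : (∑ x, ∑ y, ∑ z, ‖S' x y z‖ ^ 2) = ∑ a, ∑ b, ∑ c, ‖S a b c‖ ^ 2 :=
    calc (∑ x, ∑ y, ∑ z, ‖S' x y z‖ ^ 2)
        = ∑ a, ∑ y, ∑ z, ‖S' (e a) y z‖ ^ 2 :=
          dpdGlue_sum_eq_sum_emb hinj _ fun x hx => by simp [hOffx x hx]
      _ = ∑ a, ∑ b, ∑ z, ‖S' (e a) (e b) z‖ ^ 2 :=
          Finset.sum_congr rfl fun a _ => dpdGlue_sum_eq_sum_emb hinj _ fun y hy => by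
            simp [hOffy y hy]
      _ = ∑ a, ∑ b, ∑ c, ‖S' (e a) (e b) (e c)‖ ^ 2 :=
          Finset.sum_congr rfl fun a _ => Finset.sum_congr rfl fun b _ =>
            dpdGlue_sum_eq_sum_emb hinj _ fun z hz => by simp [hOffz z hz]
      _ = ∑ a, ∑ b, ∑ c, ‖S a b c‖ ^ 2 := by simp only [hOn]
  -- the bound at `S'`
  have hS'rank : tensorRank S' ≤ N ^ 2 := hRank.trans (hS.trans (Nat.pow_le_pow_left h 2))
  have key := hB S' hS'rank
  rwa [hOver, hNorm] at key

/-! ## Bookkeeping in one format: transport along `n = n'` and weakening of the bound -/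

/-- Transport of a capture bound along an equality of formats. [folklore] -/
theorem split_cap_congr {n n' : ℕ} (h : n = n') {B : ℝ}
    (hB : ∀ S : (Fin n × Fin n) → (Fin n × Fin n) → (Fin n × Fin n) → ℂ, tensorRank S ≤ n ^ 2 →
      ‖∑ a, ∑ b, ∑ c, S a b c * matMulTensor ℂ n n n a b c‖ ^ 2 ≤ B * ∑ a, ∑ b, ∑ c, ‖S a b c‖ ^ 2) :
    ∀ S : (Fin n' × Fin n') → (Fin n' × Fin n') → (Fin n' × Fin n') → ℂ, tensorRank S ≤ n' ^ 2 →
      ‖∑ a, ∑ b, ∑ c, S a b c * matMulTensor ℂ n' n' n' a b c‖ ^ 2 ≤ B * ∑ a, ∑ b, ∑ c, ‖S a b c‖ ^ 2 := by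
  subst h
  exact hB

/-- Weakening of a capture bound `B ≤ B'`. [folklore] -/
theorem split_cap_mono {n : ℕ} {B B' : ℝ} (hBB' : B ≤ B')
    (hB : ∀ S : (Fin n × Fin n) → (Fin n × Fin n) → (Fin n × Fin n) → ℂ, tensorRank S ≤ n ^ 2 →
      ‖∑ a, ∑ b, ∑ c, S a b c * matMulTensor ℂ n n n a b c‖ ^ 2 ≤ B * ∑ a, ∑ b, ∑ c, ‖S a b c‖ ^ 2) :
    ∀ S : (Fin n × Fin n) → (Fin n × Fin n) → (Fin n × Fin n) → ℂ, tensorRank S ≤ n ^ 2 →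
      ‖∑ a, ∑ b, ∑ c, S a b c * matMulTensor ℂ n n n a b c‖ ^ 2 ≤ B' * ∑ a, ∑ b, ∑ c, ‖S a b c‖ ^ 2 := by
  intro S hS
  have hsum : 0 ≤ ∑ a : Fin n × Fin n, ∑ b : Fin n × Fin n, ∑ c : Fin n × Fin n, ‖S a b c‖ ^ 2 := by
    positivity
  exact (hB S hS).trans (mul_le_mul_of_nonneg_right hBB' hsum)

/-! ## Real-number bookkeeping: `n₁^{1/n₁} ≤ 2` and the final exponent comparison -/

/-- `x^{1/x} ≤ 2` at every natural number `x = n₁ ≥ 1` (from `n₁ ≤ 2^{n₁}`). [folklore] -/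
theorem split_rpow_inv_le_two {n₁ : ℕ} (hn : 1 ≤ n₁) :
    (n₁ : ℝ) ^ ((n₁ : ℝ)⁻¹) ≤ 2 := by
  have hx0 : (0 : ℝ) < n₁ := by exact_mod_cast hn
  have hle : (n₁ : ℝ) ≤ (2 : ℝ) ^ (n₁ : ℝ) := by
    rw [Real.rpow_natCast]
    exact_mod_cast (Nat.lt_two_pow_self).le
  calc (n₁ : ℝ) ^ ((n₁ : ℝ)⁻¹) ≤ ((2 : ℝ) ^ (n₁ : ℝ)) ^ ((n₁ : ℝ)⁻¹) :=
        Real.rpow_le_rpow hx0.le hle (inv_nonneg.2 hx0.le)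
    _ = 2 := by
        rw [← Real.rpow_mul (by norm_num : (0 : ℝ) ≤ 2), mul_inv_cancel₀ hx0.ne', Real.rpow_one]

/-- The exponent comparison: for `n₁ ≥ 2` and `n₁^j ≤ n`,
`(n₁³/2)^{j+1} ≤ n₁³ · n^{3 − 1/n₁}`. [folklore] -/
theorem split_bound_compare {n₁ j n : ℕ} (hn₁ : 2 ≤ n₁) (hjn : n₁ ^ j ≤ n) :
    ((n₁ : ℝ) ^ 3 / 2) ^ (j + 1) ≤ (n₁ : ℝ) ^ 3 * (n : ℝ) ^ ((3 : ℝ) - (n₁ : ℝ)⁻¹) := by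
  have hx0 : (0 : ℝ) < n₁ := by exact_mod_cast (by omega : 0 < n₁)
  have hx1 : (1 : ℝ) ≤ n₁ := by exact_mod_cast (by omega : 1 ≤ n₁)
  -- exponent `3 − 1/n₁ ≥ 0`
  have hinv1 : (n₁ : ℝ)⁻¹ ≤ 1 := inv_le_one_of_one_le₀ hx1
  have hexp0 : (0 : ℝ) ≤ 3 - (n₁ : ℝ)⁻¹ := by linarith
  -- one step: `n₁³/2 ≤ n₁^{3 − 1/n₁}`
  have hstep : (n₁ : ℝ) ^ 3 / 2 ≤ (n₁ : ℝ) ^ ((3 : ℝ) - (n₁ : ℝ)⁻¹) := by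
    have h2 := split_rpow_inv_le_two (by omega : 1 ≤ n₁)
    have hpos : (0 : ℝ) < (n₁ : ℝ) ^ ((n₁ : ℝ)⁻¹) := Real.rpow_pos_of_pos hx0 _
    rw [Real.rpow_sub hx0, show ((3 : ℝ)) = ((3 : ℕ) : ℝ) by norm_num, Real.rpow_natCast,
      div_le_div_iff₀ (by norm_num : (0 : ℝ) < 2) hpos]
    exact mul_le_mul_of_nonneg_left h2 (by positivity)
  -- `j` steps: `(n₁³/2)^j ≤ (n₁^j)^{3 − 1/n₁} ≤ n^{3 − 1/n₁}`
  have hpowj : ((n₁ : ℝ) ^ 3 / 2) ^ j ≤ (n : ℝ) ^ ((3 : ℝ) - (n₁ : ℝ)⁻¹) :=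
    calc ((n₁ : ℝ) ^ 3 / 2) ^ j ≤ ((n₁ : ℝ) ^ ((3 : ℝ) - (n₁ : ℝ)⁻¹)) ^ j :=
          pow_le_pow_left₀ (by positivity) hstep j
      _ = (((n₁ : ℝ) ^ j) ^ ((3 : ℝ) - (n₁ : ℝ)⁻¹)) := by
          rw [← Real.rpow_mul_natCast hx0.le, mul_comm, Real.rpow_natCast_mul hx0.le]
      _ ≤ (n : ℝ) ^ ((3 : ℝ) - (n₁ : ℝ)⁻¹) := by
          refine Real.rpow_le_rpow (by positivity) ?_ hexp0
          exact_mod_cast hjn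
  -- assemble
  have h3 : (n₁ : ℝ) ^ 3 / 2 ≤ (n₁ : ℝ) ^ 3 := by
    have : (0 : ℝ) ≤ (n₁ : ℝ) ^ 3 := by positivity
    linarith
  calc ((n₁ : ℝ) ^ 3 / 2) ^ (j + 1) = (n₁ : ℝ) ^ 3 / 2 * ((n₁ : ℝ) ^ 3 / 2) ^ j := by ring
    _ ≤ (n₁ : ℝ) ^ 3 * (n : ℝ) ^ ((3 : ℝ) - (n₁ : ℝ)⁻¹) :=
        mul_le_mul h3 hpowj (by positivity) (by positivity)

/-! ## The split: `QualitativeDiagonalDecay → BoundedSynergy → DiagonalPowerDecay` -/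

/-- **The strategist's decomposition of the crux** (`stmt-MatrixMultiplication-14053`).
QUALITATIVE DIAGONAL DECAY (`φ(n) → 0`, first hypothesis, verbatim the hypothesis of the landed
`superlinear_tensorRank_of_qualitativeDecay`) and BOUNDED SYNERGY (`M(n·m) ≤ C·M(n)·M(m)` in witness form, second
hypothesis) together imply `DiagonalPowerDecay`, with witness `δ = 1/(2n₁)`, `C = n₁³`.  See the module docstring for
the four steps (one small scale from `QD`; iteration of `BS` along `n₁^{k+1} = n₁^k·n₁`; padding monotonicity;
`n₁^{1/n₁} ≤ 2`). [folklore] -/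
theorem DiagonalPowerDecay_of_subs
    (hQ : ∀ ε : ℝ, 0 < ε → ∃ N : ℕ, ∀ n : ℕ, N ≤ n →
      ∀ S : (Fin n × Fin n) → (Fin n × Fin n) → (Fin n × Fin n) → ℂ, tensorRank S ≤ n ^ 2 →
        ‖∑ a, ∑ b, ∑ c, S a b c * matMulTensor ℂ n n n a b c‖ ^ 2 ≤
          ε * (n : ℝ) ^ 3 * ∑ a, ∑ b, ∑ c, ‖S a b c‖ ^ 2)
    (hBS : ∃ C : ℝ, ∀ n m : ℕ, ∀ Bn Bm : ℝ,
      (∀ S : (Fin n × Fin n) → (Fin n × Fin n) → (Fin n × Fin n) → ℂ, tensorRank S ≤ n ^ 2 →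
        ‖∑ a, ∑ b, ∑ c, S a b c * matMulTensor ℂ n n n a b c‖ ^ 2 ≤
          Bn * ∑ a, ∑ b, ∑ c, ‖S a b c‖ ^ 2) →
      (∀ S : (Fin m × Fin m) → (Fin m × Fin m) → (Fin m × Fin m) → ℂ, tensorRank S ≤ m ^ 2 →
        ‖∑ a, ∑ b, ∑ c, S a b c * matMulTensor ℂ m m m a b c‖ ^ 2 ≤
          Bm * ∑ a, ∑ b, ∑ c, ‖S a b c‖ ^ 2) →
      ∀ S : (Fin (n * m) × Fin (n * m)) → (Fin (n * m) × Fin (n * m)) → (Fin (n * m) × Fin (n * m)) → ℂ,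
        tensorRank S ≤ (n * m) ^ 2 →
        ‖∑ a, ∑ b, ∑ c, S a b c * matMulTensor ℂ (n * m) (n * m) (n * m) a b c‖ ^ 2 ≤
          C * Bn * Bm * ∑ a, ∑ b, ∑ c, ‖S a b c‖ ^ 2) :
    DiagonalPowerDecay := by
  classical
  -- (0) the synergy constant, w.l.o.g. `≥ 1`
  obtain ⟨C₀, hC₀⟩ := hBS
  set C : ℝ := max C₀ 1 with hCdef
  have hC1 : 1 ≤ C := le_max_right _ _
  have hC0 : 0 < C := lt_of_lt_of_le one_pos hC1
  have hBS' : ∀ (n m : ℕ) (Bn Bm : ℝ), 0 ≤ Bn → 0 ≤ Bm →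
      (∀ S : (Fin n × Fin n) → (Fin n × Fin n) → (Fin n × Fin n) → ℂ, tensorRank S ≤ n ^ 2 →
        ‖∑ a, ∑ b, ∑ c, S a b c * matMulTensor ℂ n n n a b c‖ ^ 2 ≤
          Bn * ∑ a, ∑ b, ∑ c, ‖S a b c‖ ^ 2) →
      (∀ S : (Fin m × Fin m) → (Fin m × Fin m) → (Fin m × Fin m) → ℂ, tensorRank S ≤ m ^ 2 →
        ‖∑ a, ∑ b, ∑ c, S a b c * matMulTensor ℂ m m m a b c‖ ^ 2 ≤
          Bm * ∑ a, ∑ b, ∑ c, ‖S a b c‖ ^ 2) →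
      ∀ S : (Fin (n * m) × Fin (n * m)) → (Fin (n * m) × Fin (n * m)) → (Fin (n * m) × Fin (n * m)) → ℂ,
        tensorRank S ≤ (n * m) ^ 2 →
        ‖∑ a, ∑ b, ∑ c, S a b c * matMulTensor ℂ (n * m) (n * m) (n * m) a b c‖ ^ 2 ≤
          C * Bn * Bm * ∑ a, ∑ b, ∑ c, ‖S a b c‖ ^ 2 := by
    intro n m Bn Bm hBn hBm hn hm S hS
    have hsum : 0 ≤ ∑ a : Fin (n * m) × Fin (n * m), ∑ b : Fin (n * m) × Fin (n * m),
        ∑ c : Fin (n * m) × Fin (n * m), ‖S a b c‖ ^ 2 := by positivity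
    calc ‖∑ a, ∑ b, ∑ c, S a b c * matMulTensor ℂ (n * m) (n * m) (n * m) a b c‖ ^ 2
        ≤ C₀ * Bn * Bm * ∑ a, ∑ b, ∑ c, ‖S a b c‖ ^ 2 := hC₀ n m Bn Bm hn hm S hS
      _ ≤ C * Bn * Bm * ∑ a, ∑ b, ∑ c, ‖S a b c‖ ^ 2 := by
          refine mul_le_mul_of_nonneg_right ?_ hsum
          have : C₀ ≤ C := le_max_left _ _
          have hBB : 0 ≤ Bn * Bm := mul_nonneg hBn hBm
          nlinarith
  -- (1) one small scale from qualitative decay: `M(n₁) ≤ n₁³/(2C)`, `n₁ ≥ 2`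
  obtain ⟨N, hN⟩ := hQ (1 / (2 * C)) (by positivity)
  set n₁ : ℕ := max N 2 with hn₁def
  have hn₁2 : 2 ≤ n₁ := le_max_right _ _
  have hNn₁ : N ≤ n₁ := le_max_left _ _
  have hx0 : (0 : ℝ) < n₁ := by exact_mod_cast (by omega : 0 < n₁)
  have hbase : ∀ S : (Fin n₁ × Fin n₁) → (Fin n₁ × Fin n₁) → (Fin n₁ × Fin n₁) → ℂ,
      tensorRank S ≤ n₁ ^ 2 →
        ‖∑ a, ∑ b, ∑ c, S a b c * matMulTensor ℂ n₁ n₁ n₁ a b c‖ ^ 2 ≤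
          (1 / (2 * C) * (n₁ : ℝ) ^ 3) * ∑ a, ∑ b, ∑ c, ‖S a b c‖ ^ 2 := by
    intro S hS
    have := hN n₁ hNn₁ S hS
    simpa [mul_assoc] using this
  have hbase0 : 0 ≤ 1 / (2 * C) * (n₁ : ℝ) ^ 3 := by positivity
  -- (2) iteration of bounded synergy along `n₁^{k+1} = n₁^k · n₁`: `M(n₁^{k+1}) ≤ (n₁³/2)^{k+1}`
  have hiter : ∀ k : ℕ, ∀ S : (Fin (n₁ ^ (k + 1)) × Fin (n₁ ^ (k + 1))) →
      (Fin (n₁ ^ (k + 1)) × Fin (n₁ ^ (k + 1))) → (Fin (n₁ ^ (k + 1)) × Fin (n₁ ^ (k + 1))) → ℂ,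
      tensorRank S ≤ (n₁ ^ (k + 1)) ^ 2 →
        ‖∑ a, ∑ b, ∑ c, S a b c * matMulTensor ℂ (n₁ ^ (k + 1)) (n₁ ^ (k + 1)) (n₁ ^ (k + 1)) a b c‖ ^ 2 ≤
          ((n₁ : ℝ) ^ 3 / 2) ^ (k + 1) * ∑ a, ∑ b, ∑ c, ‖S a b c‖ ^ 2 := by
    intro k
    induction k with
    | zero =>
      -- format `n₁ ^ 1 = n₁`; bound `n₁³/(2C) ≤ (n₁³/2)^1`
      have hle : 1 / (2 * C) * (n₁ : ℝ) ^ 3 ≤ ((n₁ : ℝ) ^ 3 / 2) ^ (0 + 1) := by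
        rw [zero_add, pow_one, div_eq_mul_one_div ((n₁ : ℝ) ^ 3), mul_comm]
        refine mul_le_mul_of_nonneg_left ?_ (by positivity)
        rw [div_le_div_iff₀ (by positivity) (by norm_num : (0 : ℝ) < 2)]
        linarith
      exact split_cap_congr (pow_one n₁).symm (split_cap_mono hle hbase)
    | succ k ih =>
      -- `BS` at `(n₁^{k+1}, n₁)` with bounds `(n₁³/2)^{k+1}` and `n₁³/(2C)`
      have hprod := hBS' (n₁ ^ (k + 1)) n₁ (((n₁ : ℝ) ^ 3 / 2) ^ (k + 1)) (1 / (2 * C) * (n₁ : ℝ) ^ 3)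
        (by positivity) hbase0 ih hbase
      have hval : C * ((n₁ : ℝ) ^ 3 / 2) ^ (k + 1) * (1 / (2 * C) * (n₁ : ℝ) ^ 3) =
          ((n₁ : ℝ) ^ 3 / 2) ^ (k + 1 + 1) := by
        field_simp
        ring
      rw [hval] at hprod
      exact split_cap_congr (pow_succ n₁ (k + 1)).symm hprod
  -- (3) the witness `(C, δ) = (n₁³, 1/(2n₁))`
  refine ⟨(n₁ : ℝ) ^ 3, 1 / (2 * (n₁ : ℝ)), by positivity, fun n S hS => ?_⟩
  have hexp : (3 : ℝ) - 2 * (1 / (2 * (n₁ : ℝ))) = 3 - (n₁ : ℝ)⁻¹ := by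
    field_simp
  rw [hexp]
  rcases Nat.eq_zero_or_pos n with rfl | hn
  · -- the `0 × 0` format: both sides vanish
    simp
  · -- `n₁^j ≤ n < n₁^{j+1}` with `j = Nat.log n₁ n`; pad `S` into the `n₁^{j+1}` format
    set j : ℕ := Nat.log n₁ n with hjdef
    have hlt : n < n₁ ^ (j + 1) := Nat.lt_pow_succ_log_self (by omega : 1 < n₁) n
    have hle : n₁ ^ j ≤ n := Nat.pow_log_le_self n₁ (by omega : n ≠ 0)
    have hcap := split_capture_pad hlt.le (hiter j) S hS
    have hsum : 0 ≤ ∑ a : Fin n × Fin n, ∑ b : Fin n × Fin n, ∑ c : Fin n × Fin n, ‖S a b c‖ ^ 2 := by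
      positivity
    calc ‖∑ a, ∑ b, ∑ c, S a b c * matMulTensor ℂ n n n a b c‖ ^ 2
        ≤ ((n₁ : ℝ) ^ 3 / 2) ^ (j + 1) * ∑ a, ∑ b, ∑ c, ‖S a b c‖ ^ 2 := hcap
      _ ≤ (n₁ : ℝ) ^ 3 * (n : ℝ) ^ ((3 : ℝ) - (n₁ : ℝ)⁻¹) * ∑ a, ∑ b, ∑ c, ‖S a b c‖ ^ 2 :=
          mul_le_mul_of_nonneg_right (split_bound_compare hn₁2 hle) hsum

/-- **Bounded synergy is all that separates qualitative from power decay**: under `BS`, the qualitative decay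
`φ(n) → 0` and the crux `DiagonalPowerDecay` are EQUIVALENT (`⇐` is the landed
`qualitativeDecay_of_diagonalPowerDecay`). [folklore] -/
theorem diagonalPowerDecay_iff_qualitativeDecay_of_boundedSynergy
    (hBS : ∃ C : ℝ, ∀ n m : ℕ, ∀ Bn Bm : ℝ,
      (∀ S : (Fin n × Fin n) → (Fin n × Fin n) → (Fin n × Fin n) → ℂ, tensorRank S ≤ n ^ 2 →
        ‖∑ a, ∑ b, ∑ c, S a b c * matMulTensor ℂ n n n a b c‖ ^ 2 ≤
          Bn * ∑ a, ∑ b, ∑ c, ‖S a b c‖ ^ 2) →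
      (∀ S : (Fin m × Fin m) → (Fin m × Fin m) → (Fin m × Fin m) → ℂ, tensorRank S ≤ m ^ 2 →
        ‖∑ a, ∑ b, ∑ c, S a b c * matMulTensor ℂ m m m a b c‖ ^ 2 ≤
          Bm * ∑ a, ∑ b, ∑ c, ‖S a b c‖ ^ 2) →
      ∀ S : (Fin (n * m) × Fin (n * m)) → (Fin (n * m) × Fin (n * m)) → (Fin (n * m) × Fin (n * m)) → ℂ,
        tensorRank S ≤ (n * m) ^ 2 →
        ‖∑ a, ∑ b, ∑ c, S a b c * matMulTensor ℂ (n * m) (n * m) (n * m) a b c‖ ^ 2 ≤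
          C * Bn * Bm * ∑ a, ∑ b, ∑ c, ‖S a b c‖ ^ 2) :
    DiagonalPowerDecay ↔
      (∀ ε : ℝ, 0 < ε → ∃ N : ℕ, ∀ n : ℕ, N ≤ n →
        ∀ S : (Fin n × Fin n) → (Fin n × Fin n) → (Fin n × Fin n) → ℂ, tensorRank S ≤ n ^ 2 →
          ‖∑ a, ∑ b, ∑ c, S a b c * matMulTensor ℂ n n n a b c‖ ^ 2 ≤
            ε * (n : ℝ) ^ 3 * ∑ a, ∑ b, ∑ c, ‖S a b c‖ ^ 2) :=
  ⟨qualitativeDecay_of_diagonalPowerDecay, fun hQ => DiagonalPowerDecay_of_subs hQ hBS⟩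

end Summit.MatrixMultiplication.MatrixMultiplication.Theorems.DiagonalPowerDecay
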